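import Summits.PneNP.PneNP.Theorems.ChebyshevTracialDesignAmplitudeOneOfAllDirections
import Summits.PneNP.PneNP.Theorems.ChebyshevTracialDesignPairContainmentSparseFields
import HarnessLib

/-!
# Cell pnp-psdrank, route `ChebyshevTracialDesign`: THE 𝒜₁ RUNG FOR VERTEX-SPARSE DEGREE-ONE FACTORS WITH AN ARBITRARY MASK — unconditional, every
# dimension (brick 167; crux `TracialDecayExp20`, stmt-PneNP-19878)

Brick 167 (prover g32; MEMO-35 §3). Brick 150 (`…AmplitudeOneOfAllDirections.amplitudeOne_of_allDirections`) turns an all-directions containment bound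
for a mask `f` into the crux's value bound on the amplitude-one class `𝒜₁(f) = {X_U = f(U)·B_UB_Uᵀ : B_U = Σ_p x_p β_p, B_UB_Uᵀ ⪯ I}`, for EVERY `β`.
Brick 166 (`…PairContainmentSparseFields`) prices the containment form for EVERY mask but only in direction fields SUPPORTED ON A FIXED VERTEX SET `S`.
The two meet when the factor is supported on `S` (`β_p = 0` for `p ∉ S`): in brick 106's SOS step the only directions that occur are
`g_p = (S'β_p)_{aj}`, which vanish off `S`. This file is brick 150 with the support threaded through:
* §1 `value_amplitudeOne_le_of_CG1_supported`, `value_amplitudeOne_le_of_CG1_dim_supported` — bricks 106/108 for an `S`-supported factor, with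
  CG_1 assumed only in `S`-supported directions; §2 `CG1_of_cubeMax_supported` — CG_1 in `S`-supported directions from a maximiser over the
  `S`-supported cube (2-homogeneity).
* §3 **`amplitudeOne_of_supportedDirections`** — brick 150 for `S`-supported factors: if `Σ_M Σ_U W f C_{c_M}² ≤ Ball·G·E` for every field `|c_M| ≤ 1`
  SUPPORTED ON `S`, then `Σ_{U,M} W f tr(B_UB_UᵀY_M) ≤ 8·(Ball·G·E + 60·G·n⁴·√P_{dq n−4})·r` for every `S`-supported degree-one contraction factor
  and every `0 ⪯ Y_M ⪯ I` (no pair-symmetrisation is needed: brick 166 takes arbitrary fields).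
* §4 **`sparseFactor_amplitudeOne_value_le`** — UNCONDITIONAL: for some `a > 0` and all large even `n`, every balanced `B = 20` Chebyshev design
  `(t,C,w)`, every vertex set `S`, EVERY mask `0 ≤ f ≤ G` (no structure: spread masks included), every degree-one factor `B_U = Σ_{p∈S} x_p β_p` with
  `B_UB_Uᵀ ⪯ I` on the `t`-cuts and every psd contraction field `Y` of any dimension `r`:
  `Σ_{U,M} W(U,M)·f(U)·tr(B_UB_UᵀY_M) ≤ 8·(20·G·|S|²·(2n)^{|S|}·e^{−a·dq n} + 60·G·n⁴·√P_{dq n−4})·r` — exponentially small in `dq n ≍ n^{1/4}`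
  while `|S| ≤ a·dq n/(2 ln(2n))`.
READING. The first 𝒜₁-type rung with an UNRESTRICTED amplitude mask: the cell's earlier 𝒜₁ rungs (115 juntas, 146 `H`-symmetric, 149 mixtures, 154–156
small blocks, 163d/e juntas on `≤ n^{5/8}/10` coordinates) all constrain the MASK and allow every factor; here the FACTOR is vertex-sparse and the mask
is free. The open heart of the rung is thus «dense factor support × spread mask» (brick 165: per-cut virtual nonpositivity for densely supported,
sign-incoherent, `M`-adapted fields). [cite: GriblingDelaatLaurent2019, §5] [cite: Rothvoss2017, §2 and Lemma 7 (PDF pp. 5–8)]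
[cite: BrietDadushPokutta2014, Thm. 6 (§3)] [cite: KeevashLifshitz2023, Thm. 1.8]
Stature: support/instrument (kernel lane, no defs, axioms standard) — a RUNG-type statement for a named strategy class, ASYMPTOTIC (`∃ n₀`).
WHAT THIS IS NOT: nothing for densely supported factors, no proof or refutation of `TracialDecayExp20`, nothing on psd rank of P_PM(K_n) beyond the
rungs, no P-vs-NP content. Supports stmt-PneNP-19878.
-/

set_option linter.dupNamespace false -- `Summit.PneNP.PneNP.…`: summit = sub-problem (D-0017)

noncomputable section

namespace Summit.PneNP.PneNP.Theorems.ChebyshevTracialDesignSparseFactorAmplitudeOne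

open Finset Matrix Literature.Barriers.PneNP Literature.Combinatorics.Optimization
open Literature.Computation.Certificates.SemidefiniteComplementarity (exists_eq_conjTranspose_mul_self)
open Summit.PneNP.PneNP.Theorems.ChebyshevTracialDesignAmplitudeOneReduction (trace_mul_transpose_mul_gram mul_sum_smul_apply
  trace_transpose_mul_mul_le)
open Summit.PneNP.PneNP.Theorems.ChebyshevTracialDesignDegreeOneFrobeniusMass (frobeniusMass_le_of_contraction)
open Summit.PneNP.PneNP.Theorems.ChebyshevTracialDesignContainmentReduction (value_sq_sub_containment_abs_le)
open Summit.PneNP.PneNP.Theorems.ChebyshevTracialDesignCrossingPlaneAverage (dq_Tq_facts)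
open Summit.PneNP.PneNP.Theorems.ChebyshevTracialDesignHSymmetricAmplitudeOne (exists_cube_max continuous_linearForm four_le_dq)
open Summit.PneNP.PneNP.Theorems.ChebyshevTracialDesignPairContainmentSparseFields (sum_posPart_containment_le_of_support)
open Summit.PneNP.PneNP.Theorems.ChebyshevTracialDesignUnconditionalRungs (rectangleDecayExp_all_holds)

variable {n : ℕ}

/-! ### §1 Bricks 106/108 with the support threaded through -/

/-- **CG_1 in `S`-supported directions ⟹ the value on `𝒜₁` for an `S`-supported factor** (brick 106 with support): for any weight `W`, mask `f`,
factor `B_U = Σ_p x_pβ_p` with `β_p = 0` off `S`, psd `Y`, and `Σ_U W(U,M) f(U)(Σ_p g_p x_p)² ≤ ε_M·Σ_p g_p²` for every `M` and every `g` vanishing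
off `S`: `Σ_{U,M} W f tr(B_UB_UᵀY_M) ≤ Σ_M ε_M·Σ_p tr(β_pᵀY_Mβ_p)`. [cite: GriblingDelaatLaurent2019, §5] [cite: Rothvoss2017, §2 (PDF p. 6)] -/
theorem value_amplitudeOne_le_of_CG1_supported {r m : ℕ} (W : OddSet n → PMatch n → ℝ) (f : OddSet n → ℝ) (S : Finset (Fin n))
    (β : Fin n → Matrix (Fin r) (Fin m) ℝ) (hβS : ∀ p, p ∉ S → β p = 0)
    (Y : PMatch n → Matrix (Fin r) (Fin r) ℝ) (hY : ∀ M, (Y M).PosSemidef) (ε : PMatch n → ℝ)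
    (hCG : ∀ (M : PMatch n) (g : Fin n → ℝ), (∀ p, p ∉ S → g p = 0) →
      ∑ U : OddSet n, W U M * (f U * (∑ p, g p * (if p ∈ U.1 then (1 : ℝ) else 0)) ^ 2) ≤ ε M * ∑ p, g p ^ 2) :
    ∑ U : OddSet n, ∑ M : PMatch n, W U M *
        (f U * ((∑ p, (if p ∈ U.1 then (1 : ℝ) else 0) • β p) * (∑ p, (if p ∈ U.1 then (1 : ℝ) else 0) • β p)ᵀ * Y M).trace) ≤
      ∑ M : PMatch n, ε M * ∑ p, ((β p)ᵀ * Y M * β p).trace := by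
  rw [sum_comm]
  refine sum_le_sum fun M _ => ?_
  obtain ⟨S', hS⟩ := exists_eq_conjTranspose_mul_self (hY M)
  have hS' : Y M = S'ᵀ * S' := by rw [hS, conjTranspose_eq_transpose_of_trivial]
  set x : OddSet n → Fin n → ℝ := fun U p => if p ∈ U.1 then (1 : ℝ) else 0 with hx
  have hval : ∀ U : OddSet n, ((∑ p, x U p • β p) * (∑ p, x U p • β p)ᵀ * Y M).trace =
      ∑ a, ∑ j, (∑ p, x U p * (S' * β p) a j) ^ 2 := fun U => by
    rw [hS', trace_mul_transpose_mul_gram]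
    exact sum_congr rfl fun a _ => sum_congr rfl fun j _ => by rw [mul_sum_smul_apply]
  have hlhs : ∑ U : OddSet n, W U M * (f U * ((∑ p, x U p • β p) * (∑ p, x U p • β p)ᵀ * Y M).trace) =
      ∑ a, ∑ j, ∑ U : OddSet n, W U M * (f U * (∑ p, (S' * β p) a j * x U p) ^ 2) := by
    calc ∑ U : OddSet n, W U M * (f U * ((∑ p, x U p • β p) * (∑ p, x U p • β p)ᵀ * Y M).trace)
        = ∑ U : OddSet n, ∑ a, ∑ j, W U M * (f U * (∑ p, (S' * β p) a j * x U p) ^ 2) := by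
          refine sum_congr rfl fun U _ => ?_
          rw [hval U, mul_sum, mul_sum]
          refine sum_congr rfl fun a _ => ?_
          rw [mul_sum, mul_sum]
          refine sum_congr rfl fun j _ => ?_
          congr 2
          exact congrArg (· ^ 2) (sum_congr rfl fun p _ => mul_comm _ _)
      _ = ∑ a, ∑ U : OddSet n, ∑ j, W U M * (f U * (∑ p, (S' * β p) a j * x U p) ^ 2) := sum_comm
      _ = ∑ a, ∑ j, ∑ U : OddSet n, W U M * (f U * (∑ p, (S' * β p) a j * x U p) ^ 2) := sum_congr rfl fun a _ => sum_comm
  have hrhs : ∑ p, ((β p)ᵀ * Y M * β p).trace = ∑ a, ∑ j, ∑ p, (S' * β p) a j ^ 2 := by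
    calc ∑ p, ((β p)ᵀ * Y M * β p).trace = ∑ p, ∑ a, ∑ j, (S' * β p) a j ^ 2 := by
          refine sum_congr rfl fun p _ => ?_
          have : ((β p)ᵀ * Y M * β p).trace = ((S' * β p)ᵀ * (S' * β p)).trace := by
            rw [hS', Matrix.transpose_mul, Matrix.mul_assoc, Matrix.mul_assoc, ← Matrix.mul_assoc (β p)ᵀ]
          rw [this, Matrix.trace_mul_comm]
          simp only [Matrix.trace, Matrix.diag_apply, Matrix.mul_apply, Matrix.transpose_apply]
          exact sum_congr rfl fun a _ => sum_congr rfl fun j _ => by ring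
      _ = ∑ a, ∑ p, ∑ j, (S' * β p) a j ^ 2 := sum_comm
      _ = ∑ a, ∑ j, ∑ p, (S' * β p) a j ^ 2 := sum_congr rfl fun a _ => sum_comm
  rw [hlhs, hrhs, mul_sum]
  refine sum_le_sum fun a _ => ?_
  rw [mul_sum]
  refine sum_le_sum fun j _ => ?_
  exact hCG M (fun p => (S' * β p) a j) (fun p hp => by rw [hβS p hp, Matrix.mul_zero]; rfl)

/-- **… at every dimension, contraction form** (bricks 106/108 with support): if moreover `Y_M ⪯ I` and `B_UB_Uᵀ ⪯ I` on the `t`-cuts (`0 < t < n`, a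
`t`-cut exists), then `Σ_{U,M} W f tr(B_UB_UᵀY_M) ≤ (Σ_M (ε_M)₊)·r·n(n−1)/(t(n−t))`. [cite: GriblingDelaatLaurent2019, §5] [cite: Rothvoss2017, §2 (PDF p. 6)] -/
theorem value_amplitudeOne_le_of_CG1_dim_supported {r m t : ℕ} (ht0 : 0 < t) (htn : t < n)
    (hT : 0 < (univ.filter fun U : OddSet n => U.1.card = t).card)
    (W : OddSet n → PMatch n → ℝ) (f : OddSet n → ℝ) (S : Finset (Fin n)) (β : Fin n → Matrix (Fin r) (Fin m) ℝ)
    (hβS : ∀ p, p ∉ S → β p = 0)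
    (hB : ∀ U : OddSet n, U.1.card = t →
      (1 - (∑ p, (if p ∈ U.1 then (1 : ℝ) else 0) • β p) * (∑ p, (if p ∈ U.1 then (1 : ℝ) else 0) • β p)ᵀ).PosSemidef)
    (Y : PMatch n → Matrix (Fin r) (Fin r) ℝ) (hY : ∀ M, (Y M).PosSemidef ∧ (1 - Y M).PosSemidef) (ε : PMatch n → ℝ)
    (hCG : ∀ (M : PMatch n) (g : Fin n → ℝ), (∀ p, p ∉ S → g p = 0) →
      ∑ U : OddSet n, W U M * (f U * (∑ p, g p * (if p ∈ U.1 then (1 : ℝ) else 0)) ^ 2) ≤ ε M * ∑ p, g p ^ 2) :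
    ∑ U : OddSet n, ∑ M : PMatch n, W U M *
        (f U * ((∑ p, (if p ∈ U.1 then (1 : ℝ) else 0) • β p) * (∑ p, (if p ∈ U.1 then (1 : ℝ) else 0) • β p)ᵀ * Y M).trace) ≤
      (∑ M : PMatch n, max (ε M) 0) * ((r : ℝ) * ((n : ℝ) * ((n : ℝ) - 1)) / ((t : ℝ) * ((n : ℝ) - t))) := by
  have hCG' : ∀ (M : PMatch n) (g : Fin n → ℝ), (∀ p, p ∉ S → g p = 0) →
      ∑ U : OddSet n, W U M * (f U * (∑ p, g p * (if p ∈ U.1 then (1 : ℝ) else 0)) ^ 2) ≤ max (ε M) 0 * ∑ p, g p ^ 2 :=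
    fun M g hg => (hCG M g hg).trans (mul_le_mul_of_nonneg_right (le_max_left _ _) (sum_nonneg fun p _ => sq_nonneg _))
  refine (value_amplitudeOne_le_of_CG1_supported W f S β hβS Y (fun M => (hY M).1) (fun M => max (ε M) 0) hCG').trans ?_
  have h1 : ∑ M : PMatch n, max (ε M) 0 * ∑ p, ((β p)ᵀ * Y M * β p).trace ≤
      ∑ M : PMatch n, max (ε M) 0 * ∑ p, (β p * (β p)ᵀ).trace :=
    sum_le_sum fun M _ => mul_le_mul_of_nonneg_left (sum_le_sum fun p _ => trace_transpose_mul_mul_le (β p) (hY M).2) (le_max_right _ _)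
  refine h1.trans ?_
  rw [← sum_mul]
  exact mul_le_mul_of_nonneg_left (frobeniusMass_le_of_contraction ht0 htn hT β hB) (sum_nonneg fun M _ => le_max_right _ _)

/-! ### §2 CG_1 in supported directions from a supported cube maximiser -/

/-- **CG_1 in `S`-supported directions from a maximiser over the `S`-supported cube**, by `2`-homogeneity (brick 146 §1 with support).
[folklore] -/
theorem CG1_of_cubeMax_supported (W : OddSet n → PMatch n → ℝ) (M : PMatch n) (f : OddSet n → ℝ) (S : Finset (Fin n)) (g₀ : Fin n → ℝ)
    (hmax : ∀ g : Fin n → ℝ, (∀ p, |g p| ≤ 1) → (∀ p, p ∉ S → g p = 0) →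
      ∑ U : OddSet n, W U M * (f U * (∑ p, g p * (if p ∈ U.1 then (1 : ℝ) else 0)) ^ 2) ≤
        ∑ U : OddSet n, W U M * (f U * (∑ p, g₀ p * (if p ∈ U.1 then (1 : ℝ) else 0)) ^ 2))
    (g : Fin n → ℝ) (hg : ∀ p, p ∉ S → g p = 0) :
    ∑ U : OddSet n, W U M * (f U * (∑ p, g p * (if p ∈ U.1 then (1 : ℝ) else 0)) ^ 2) ≤
      (∑ U : OddSet n, W U M * (f U * (∑ p, g₀ p * (if p ∈ U.1 then (1 : ℝ) else 0)) ^ 2)) * ∑ p, g p ^ 2 := by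
  obtain ⟨s, hs⟩ : ∃ s : ℝ, s = ∑ p, g p ^ 2 := ⟨_, rfl⟩
  have hs0 : 0 ≤ s := by rw [hs]; positivity
  rcases eq_or_lt_of_le hs0 with h0 | hpos
  · have hg0 : ∀ p, g p = 0 := fun p => by
      have := (sum_eq_zero_iff_of_nonneg (fun q _ => sq_nonneg (g q))).1 (by rw [← hs, ← h0]) p (mem_univ p)
      exact pow_eq_zero_iff (n := 2) (by norm_num) |>.1 this
    rw [← hs, ← h0, mul_zero]
    simp [hg0]
  · have hsq : Real.sqrt s ^ 2 = s := Real.sq_sqrt hs0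
    have hsqpos : 0 < Real.sqrt s := Real.sqrt_pos.2 hpos
    have hcube : ∀ p, |g p / Real.sqrt s| ≤ 1 := by
      intro p
      rw [abs_div, abs_of_pos hsqpos, div_le_one hsqpos]
      have hp : g p ^ 2 ≤ s := by rw [hs]; exact single_le_sum (f := fun q => g q ^ 2) (fun q _ => sq_nonneg _) (mem_univ p)
      calc |g p| = Real.sqrt (g p ^ 2) := (Real.sqrt_sq_eq_abs _).symm
        _ ≤ Real.sqrt s := Real.sqrt_le_sqrt hp
    have hsupp : ∀ p, p ∉ S → g p / Real.sqrt s = 0 := fun p hp => by rw [hg p hp, zero_div]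
    have key := hmax (fun p => g p / Real.sqrt s) hcube hsupp
    have hhom : ∑ U : OddSet n, W U M * (f U * (∑ p, g p * (if p ∈ U.1 then (1 : ℝ) else 0)) ^ 2) =
        s * ∑ U : OddSet n, W U M * (f U * (∑ p, g p / Real.sqrt s * (if p ∈ U.1 then (1 : ℝ) else 0)) ^ 2) := by
      rw [mul_sum]
      refine Fintype.sum_congr _ _ fun U => ?_
      have : ∑ p, g p * (if p ∈ U.1 then (1 : ℝ) else 0) = Real.sqrt s * ∑ p, g p / Real.sqrt s * (if p ∈ U.1 then (1 : ℝ) else 0) := by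
        rw [mul_sum]; refine sum_congr rfl fun p _ => ?_
        rw [show Real.sqrt s * (g p / Real.sqrt s * (if p ∈ U.1 then (1 : ℝ) else 0)) =
          Real.sqrt s / Real.sqrt s * (g p * (if p ∈ U.1 then (1 : ℝ) else 0)) by ring, div_self hsqpos.ne', one_mul]
      rw [this, mul_pow, hsq]; ring
    rw [hhom, ← hs, mul_comm]
    exact mul_le_mul_of_nonneg_right key hs0

/-! ### §3 Brick 150 for supported factors -/

set_option maxHeartbeats 400000 in -- bricks 101 and 108 instantiated in one context (as in brick 150)
/-- **THE 𝒜₁ RUNG FOR AN `S`-SUPPORTED FACTOR FROM THE CONTAINMENT BOUND IN `S`-SUPPORTED DIRECTIONS.** For an even `n ≥ 256`, a balanced exact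
design `(t, C, w)` of the crux's shape, a vertex set `S`, a mask `0 ≤ f ≤ G` whose `M`-summed containment values satisfy
`Σ_M Σ_U W f C_{c_M}² ≤ Ball·G·E` for every direction field `|c_M| ≤ 1` SUPPORTED ON `S`, every degree-one factor `B_U = Σ_p x_pβ_p` with `β_p = 0`
off `S` and `B_UB_Uᵀ ⪯ I` on the `t`-cuts, and every `0 ⪯ Y_M ⪯ I`:
`Σ_{U,M} W(U,M)·f(U)·tr(B_UB_UᵀY_M) ≤ 8·(Ball·G·E + 60·G·n⁴·√P_{dq n−4})·r`. [cite: GriblingDelaatLaurent2019, §5]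
[cite: Rothvoss2017, §2 and Lemma 7 (PDF pp. 5–8)] -/
theorem amplitudeOne_of_supportedDirections {t : ℕ} {C : Finset ℕ} {w : ℕ → ℝ} (hev : Even n) (hn256 : 256 ≤ n)
    (hdes : IsBalancedDesign n t (Tq n) (dq n) 20 C w) (S : Finset (Fin n))
    (f : Finset (Fin n) → ℝ) {G : ℝ} (hG0 : 0 ≤ G) (hf0 : ∀ U, 0 ≤ f U) (hfG : ∀ U, f U ≤ G)
    {Ball E : ℝ}
    (hall : ∀ c : PMatch n → Fin n → ℝ, (∀ M p, |c M p| ≤ 1) → (∀ M p, p ∉ S → c M p = 0) →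
      ∑ M : PMatch n, ∑ U : OddSet n, levelWeight n t C w U M * (f U.1 *
        (∑ p : Fin n, c M p * ((if p ∈ U.1 then (1 : ℝ) else 0) * (if M.2.partner p ∈ U.1 then (1 : ℝ) else 0))) ^ 2) ≤ Ball * G * E)
    {r m : ℕ} (β : Fin n → Matrix (Fin r) (Fin m) ℝ) (hβS : ∀ p, p ∉ S → β p = 0)
    (hB : ∀ U : OddSet n, U.1.card = t →
      (1 - (∑ p, (if p ∈ U.1 then (1 : ℝ) else 0) • β p) * (∑ p, (if p ∈ U.1 then (1 : ℝ) else 0) • β p)ᵀ).PosSemidef)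
    (Y : PMatch n → Matrix (Fin r) (Fin r) ℝ) (hY : ∀ M, (Y M).PosSemidef ∧ (1 - Y M).PosSemidef) :
    ∑ U : OddSet n, ∑ M : PMatch n, levelWeight n t C w U M *
        (f U.1 *
          ((∑ p, (if p ∈ U.1 then (1 : ℝ) else 0) • β p) * (∑ p, (if p ∈ U.1 then (1 : ℝ) else 0) • β p)ᵀ * Y M).trace) ≤
      8 * (Ball * G * E + 60 * G * (n : ℝ) ^ 4 *
        Real.sqrt (∏ i ∈ range ((dq n - 4) / 2 + 1), ((2 * i + 1 : ℝ) / ((n : ℝ) - 2 * i)))) * r := by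
  classical
  obtain ⟨-, -, hdqT, -⟩ := dq_Tq_facts (show 16 ≤ n by omega)
  have hD4 : 4 ≤ dq n := four_le_dq hn256
  have hex : IsExactDesign n t (Tq n) (dq n) 20 C w := hdes.1
  have hbal : n ≤ 4 * t := hdes.2
  obtain ⟨c', hc'⟩ := hex.1
  subst hc'
  have htn : 2 * (2 * c' + 1) + 2 ≤ n := hex.2.1
  have hTt : Tq n ≤ 2 * c' + 1 := hex.2.2.1
  have ht0 : 0 < 2 * c' + 1 := by omega
  have htn' : 2 * c' + 1 < n := by omega
  have hDc : dq n ≤ 2 * c' := by omega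
  have hvar : ∑ c ∈ C, |w c| ≤ 20 := hex.2.2.2.2.2.2
  -- a `t`-cut exists
  obtain ⟨c₀, hc₀⟩ := nonempty_of_exact hex.exact
  obtain ⟨q₀, hq₀⟩ := (hex.2.2.2.1 c₀ hc₀).2.2.2
  have hT : 0 < (univ.filter fun U : OddSet n => U.1.card = 2 * c' + 1).card :=
    card_pos.2 ⟨q₀.1, mem_filter.2 ⟨mem_univ _, (mem_Qset_iff.1 hq₀).1⟩⟩
  have hP0 : 0 ≤ Real.sqrt (∏ i ∈ range ((dq n - 4) / 2 + 1), ((2 * i + 1 : ℝ) / ((n : ℝ) - 2 * i))) := Real.sqrt_nonneg _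
  have hn1 : (1 : ℝ) ≤ n := by exact_mod_cast (show 1 ≤ n by omega)
  -- the degenerate case `G = 0`
  have hBall : 0 ≤ Ball * G * E := by
    have h0 := hall 0 (fun M p => by simp) (fun M p _ => rfl)
    have : ∑ M : PMatch n, ∑ U : OddSet n, levelWeight n (2 * c' + 1) C w U M * (f U.1 *
        (∑ p : Fin n, (0 : PMatch n → Fin n → ℝ) M p * ((if p ∈ U.1 then (1 : ℝ) else 0) * (if M.2.partner p ∈ U.1 then (1 : ℝ) else 0))) ^ 2) = 0 := by
      simp
    linarith
  rcases eq_or_lt_of_le hG0 with hG | hG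
  · have hψ : ∀ U, f U = 0 := fun U => le_antisymm (by rw [hG]; exact hfG U) (hf0 U)
    have hl : ∑ U : OddSet n, ∑ M : PMatch n, levelWeight n (2 * c' + 1) C w U M *
        (f U.1 * ((∑ p, (if p ∈ U.1 then (1 : ℝ) else 0) • β p) * (∑ p, (if p ∈ U.1 then (1 : ℝ) else 0) • β p)ᵀ * Y M).trace) = 0 := by
      simp [hψ]
    rw [hl]
    have hr0 : (0 : ℝ) ≤ r := Nat.cast_nonneg _
    have : 0 ≤ 60 * G * (n : ℝ) ^ 4 * Real.sqrt (∏ i ∈ range ((dq n - 4) / 2 + 1), ((2 * i + 1 : ℝ) / ((n : ℝ) - 2 * i))) := by positivity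
    positivity
  -- §1: per matching, a maximiser over the `S`-supported cube and CG_1 in `S`-supported directions
  set res : (Fin n → ℝ) → (Fin n → ℝ) := fun g p => if p ∈ S then g p else 0 with hres
  have hres_cont : Continuous res := by
    refine continuous_pi fun p => ?_
    by_cases hp : p ∈ S
    · simp only [hres, hp, if_true]; exact continuous_apply p
    · simp only [hres, hp, if_false]; exact continuous_const
  have hmaxex : ∀ M : PMatch n, ∃ g₁ : Fin n → ℝ, (∀ p, |g₁ p| ≤ 1) ∧ ∀ g : Fin n → ℝ, (∀ p, |g p| ≤ 1) →
      ∑ U : OddSet n, levelWeight n (2 * c' + 1) C w U M * (f U.1 *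
          (∑ p, res g p * (if p ∈ U.1 then (1 : ℝ) else 0)) ^ 2) ≤
        ∑ U : OddSet n, levelWeight n (2 * c' + 1) C w U M * (f U.1 *
          (∑ p, res g₁ p * (if p ∈ U.1 then (1 : ℝ) else 0)) ^ 2) :=
    fun M => exists_cube_max _ ((continuous_linearForm (levelWeight n (2 * c' + 1) C w) M (fun U => f U.1)).comp hres_cont)
  choose g₁ hg₁1 hg₁max using hmaxex
  -- the supported maximisers
  set g₀ : PMatch n → Fin n → ℝ := fun M => res (g₁ M) with hg₀
  have hg₀1 : ∀ M p, |g₀ M p| ≤ 1 := fun M p => by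
    simp only [hg₀, hres]
    split_ifs
    · exact hg₁1 M p
    · simp
  have hg₀S : ∀ M p, p ∉ S → g₀ M p = 0 := fun M p hp => by simp only [hg₀, hres, hp, if_false]
  have hres_id : ∀ g : Fin n → ℝ, (∀ p, p ∉ S → g p = 0) → res g = g := fun g hg => by
    funext p
    simp only [hres]
    split_ifs with hp
    · rfl
    · exact (hg p hp).symm
  have hg₀max : ∀ (M : PMatch n) (g : Fin n → ℝ), (∀ p, |g p| ≤ 1) → (∀ p, p ∉ S → g p = 0) →
      ∑ U : OddSet n, levelWeight n (2 * c' + 1) C w U M * (f U.1 *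
          (∑ p, g p * (if p ∈ U.1 then (1 : ℝ) else 0)) ^ 2) ≤
        ∑ U : OddSet n, levelWeight n (2 * c' + 1) C w U M * (f U.1 *
          (∑ p, g₀ M p * (if p ∈ U.1 then (1 : ℝ) else 0)) ^ 2) := by
    intro M g hg1 hgS
    have h := hg₁max M g hg1
    rw [hres_id g hgS] at h
    exact h
  have hε0 : ∀ M : PMatch n, 0 ≤ ∑ U : OddSet n, levelWeight n (2 * c' + 1) C w U M * (f U.1 *
      (∑ p, g₀ M p * (if p ∈ U.1 then (1 : ℝ) else 0)) ^ 2) := fun M => by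
    have h := hg₀max M 0 (fun p => by simp) (fun p _ => rfl)
    simpa using h
  have hCG : ∀ (M : PMatch n) (g : Fin n → ℝ), (∀ p, p ∉ S → g p = 0) →
      ∑ U : OddSet n, levelWeight n (2 * c' + 1) C w U M * (f U.1 *
          (∑ p, g p * (if p ∈ U.1 then (1 : ℝ) else 0)) ^ 2) ≤
        (∑ U : OddSet n, levelWeight n (2 * c' + 1) C w U M * (f U.1 *
          (∑ p, g₀ M p * (if p ∈ U.1 then (1 : ℝ) else 0)) ^ 2)) * ∑ p, g p ^ 2 :=
    fun M g hg => CG1_of_cubeMax_supported _ M _ S (g₀ M) (hg₀max M) g hg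
  -- bricks 106/108 with support: the value on the amplitude class
  have h108 := value_amplitudeOne_le_of_CG1_dim_supported ht0 htn' hT (levelWeight n (2 * c' + 1) C w)
    (fun U => f U.1) S β hβS hB Y hY _ hCG
  have hεsum : ∑ M : PMatch n, max (∑ U : OddSet n, levelWeight n (2 * c' + 1) C w U M * (f U.1 *
      (∑ p, g₀ M p * (if p ∈ U.1 then (1 : ℝ) else 0)) ^ 2)) 0 =
      ∑ M : PMatch n, ∑ U : OddSet n, levelWeight n (2 * c' + 1) C w U M * (f U.1 *
      (∑ p, g₀ M p * (if p ∈ U.1 then (1 : ℝ) else 0)) ^ 2) :=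
    sum_congr rfl fun M _ => max_eq_left (hε0 M)
  rw [hεsum] at h108
  -- brick 101: linear forms ↦ containment forms (mask `f/G ∈ [0,1]`)
  have hf1 : ∀ U : OddSet n, |f U.1 / G| ≤ 1 := fun U => by
    rw [abs_div, abs_of_pos hG, div_le_one hG, abs_of_nonneg (hf0 _)]; exact hfG _
  have h101 := value_sq_sub_containment_abs_le hev hex hDc hD4 (fun U => f U.1 / G) hf1 g₀ hg₀1
  have hscale : ∀ (F : PMatch n → OddSet n → ℝ),
      ∑ M : PMatch n, ∑ U : OddSet n, levelWeight n (2 * c' + 1) C w U M * (f U.1 / G * F M U) =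
      (∑ M : PMatch n, ∑ U : OddSet n, levelWeight n (2 * c' + 1) C w U M * (f U.1 * F M U)) / G := by
    intro F
    rw [sum_div]; refine sum_congr rfl fun M _ => ?_
    rw [sum_div]; refine sum_congr rfl fun U _ => ?_
    field_simp
  rw [hscale, hscale, ← sub_div, abs_div, abs_of_pos hG, div_le_iff₀ hG] at h101
  have hlin := (abs_sub_le_iff.1 h101).1
  -- the hypothesis on the supported maximising field (no pair-symmetrisation needed)
  have h166 := hall g₀ hg₀1 hg₀S
  -- the balance ratio `n(n−1)/(t(n−t)) ≤ 8`
  have htr : (n : ℝ) ≤ 4 * ((2 * c' + 1 : ℕ) : ℝ) := by exact_mod_cast hbal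
  have htn'' : 2 * ((2 * c' + 1 : ℕ) : ℝ) + 2 ≤ n := by exact_mod_cast htn
  have htpos : (0 : ℝ) < ((2 * c' + 1 : ℕ) : ℝ) * ((n : ℝ) - (2 * c' + 1 : ℕ)) := by
    apply mul_pos <;> [exact_mod_cast ht0; linarith]
  have hratio : (n : ℝ) * ((n : ℝ) - 1) / (((2 * c' + 1 : ℕ) : ℝ) * ((n : ℝ) - (2 * c' + 1 : ℕ))) ≤ 8 := by
    rw [div_le_iff₀ htpos]; nlinarith
  -- assemble
  have hL : ∑ M : PMatch n, ∑ U : OddSet n, levelWeight n (2 * c' + 1) C w U M * (f U.1 *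
      (∑ p, g₀ M p * (if p ∈ U.1 then (1 : ℝ) else 0)) ^ 2) ≤
      Ball * G * E +
        3 * (n : ℝ) ^ 4 * (20 * Real.sqrt (∏ i ∈ range ((dq n - 4) / 2 + 1), ((2 * i + 1 : ℝ) / ((n : ℝ) - 2 * i)))) * G := by
    have hw : 3 * (n : ℝ) ^ 4 * ((∑ c ∈ C, |w c|) * Real.sqrt (∏ i ∈ range ((dq n - 4) / 2 + 1),
        ((2 * i + 1 : ℝ) / ((n : ℝ) - 2 * i)))) * G ≤
        3 * (n : ℝ) ^ 4 * (20 * Real.sqrt (∏ i ∈ range ((dq n - 4) / 2 + 1), ((2 * i + 1 : ℝ) / ((n : ℝ) - 2 * i)))) * G := by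
      refine mul_le_mul_of_nonneg_right (mul_le_mul_of_nonneg_left (mul_le_mul_of_nonneg_right hvar hP0) (by positivity)) hG.le
    linarith
  refine h108.trans ?_
  have hr0 : (0 : ℝ) ≤ r := Nat.cast_nonneg _
  calc (∑ M : PMatch n, ∑ U : OddSet n, levelWeight n (2 * c' + 1) C w U M * (f U.1 *
        (∑ p, g₀ M p * (if p ∈ U.1 then (1 : ℝ) else 0)) ^ 2)) *
        ((r : ℝ) * ((n : ℝ) * ((n : ℝ) - 1)) / (((2 * c' + 1 : ℕ) : ℝ) * ((n : ℝ) - (2 * c' + 1 : ℕ))))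
      = (∑ M : PMatch n, ∑ U : OddSet n, levelWeight n (2 * c' + 1) C w U M * (f U.1 *
        (∑ p, g₀ M p * (if p ∈ U.1 then (1 : ℝ) else 0)) ^ 2)) * (r : ℝ) *
        ((n : ℝ) * ((n : ℝ) - 1) / (((2 * c' + 1 : ℕ) : ℝ) * ((n : ℝ) - (2 * c' + 1 : ℕ)))) := by ring
    _ ≤ (Ball * G * E +
        3 * (n : ℝ) ^ 4 * (20 * Real.sqrt (∏ i ∈ range ((dq n - 4) / 2 + 1), ((2 * i + 1 : ℝ) / ((n : ℝ) - 2 * i)))) * G) *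
        (r : ℝ) * 8 := by
          refine mul_le_mul (mul_le_mul_of_nonneg_right hL hr0) hratio (by positivity) ?_
          have : 0 ≤ 3 * (n : ℝ) ^ 4 * (20 * Real.sqrt (∏ i ∈ range ((dq n - 4) / 2 + 1), ((2 * i + 1 : ℝ) / ((n : ℝ) - 2 * i)))) * G := by
            positivity
          positivity
    _ = 8 * (Ball * G * E + 60 * G * (n : ℝ) ^ 4 *
        Real.sqrt (∏ i ∈ range ((dq n - 4) / 2 + 1), ((2 * i + 1 : ℝ) / ((n : ℝ) - 2 * i)))) * r := by ring

/-! ### §4 The unconditional rung for vertex-sparse factors -/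

/-- **THE 𝒜₁ RUNG FOR VERTEX-SPARSE DEGREE-ONE FACTORS AND ARBITRARY MASKS — UNCONDITIONAL, EVERY DIMENSION.** For some `a > 0` and all large even
`n`: for every balanced exact design `(t, C, w)` of degree `dq n` on levels `≤ Tq n` with `Σ|w_c| ≤ 20`, every vertex set `S`, EVERY mask
`0 ≤ f ≤ G`, every degree-one factor `B_U = Σ_p x_p β_p` with `β_p = 0` for `p ∉ S` and `B_UB_Uᵀ ⪯ I` on the `t`-cuts, and every psd contraction field
`Y` of any dimension `r`:
`Σ_{U,M} W(U,M)·f(U)·tr(B_UB_UᵀY_M) ≤ 8·(20·G·|S|²·(2n)^{|S|}·e^{−a·dq n} + 60·G·n⁴·√P_{dq n−4})·r`.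
[cite: GriblingDelaatLaurent2019, §5] [cite: Rothvoss2017, §2 and Lemma 7 (PDF pp. 5–8)] [cite: KeevashLifshitz2023, Thm. 1.8]
[cite: BrietDadushPokutta2014, Thm. 6 (§3)] -/
theorem sparseFactor_amplitudeOne_value_le :
    ∃ a : ℝ, 0 < a ∧ ∃ n₀ : ℕ, ∀ n : ℕ, n₀ ≤ n → Even n → ∀ {t : ℕ} {C : Finset ℕ} {w : ℕ → ℝ},
    IsBalancedDesign n t (Tq n) (dq n) 20 C w →
    ∀ (S : Finset (Fin n)) (f : Finset (Fin n) → ℝ) {G : ℝ}, (∀ U, 0 ≤ f U) → (∀ U, f U ≤ G) →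
    ∀ {r m : ℕ} (β : Fin n → Matrix (Fin r) (Fin m) ℝ), (∀ p, p ∉ S → β p = 0) →
    (∀ U : OddSet n, U.1.card = t →
      (1 - (∑ p, (if p ∈ U.1 then (1 : ℝ) else 0) • β p) * (∑ p, (if p ∈ U.1 then (1 : ℝ) else 0) • β p)ᵀ).PosSemidef) →
    ∀ (Y : PMatch n → Matrix (Fin r) (Fin r) ℝ), (∀ M, (Y M).PosSemidef ∧ (1 - Y M).PosSemidef) →
    ∑ U : OddSet n, ∑ M : PMatch n, levelWeight n t C w U M *
        (f U.1 *
          ((∑ p, (if p ∈ U.1 then (1 : ℝ) else 0) • β p) * (∑ p, (if p ∈ U.1 then (1 : ℝ) else 0) • β p)ᵀ * Y M).trace) ≤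
      8 * (20 * G * ((S.card : ℝ) ^ 2 * (2 * (n : ℝ)) ^ S.card) * Real.exp (-(a * (dq n : ℝ))) +
        60 * G * (n : ℝ) ^ 4 * Real.sqrt (∏ i ∈ range ((dq n - 4) / 2 + 1), ((2 * i + 1 : ℝ) / ((n : ℝ) - 2 * i)))) * r := by
  classical
  obtain ⟨a, ha, n₁, hrung⟩ := rectangleDecayExp_all_holds
  refine ⟨a, ha, max n₁ 256, ?_⟩
  intro n hn hev t C w hdes S f G hf0 hfG r m β hβS hB Y hY
  have hn₁ : n₁ ≤ n := le_trans (le_max_left _ _) hn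
  have hn256 : 256 ≤ n := le_trans (le_max_right _ _) hn
  have hR := hrung n hn₁ hev t C w hdes
  -- `G ≥ 0` from any `t`-cut... or from the empty set: `0 ≤ f ∅ ≤ G`
  have hG0 : 0 ≤ G := (hf0 ∅).trans (hfG ∅)
  set E : ℝ := ((S.card : ℝ) ^ 2 * (2 * (n : ℝ)) ^ S.card) * (20 * Real.exp (-(a * (dq n : ℝ)))) with hE
  -- the containment bound in `S`-supported directions (brick 166 at the mask `f/G`)
  have hall : ∀ c : PMatch n → Fin n → ℝ, (∀ M p, |c M p| ≤ 1) → (∀ M p, p ∉ S → c M p = 0) →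
      ∑ M : PMatch n, ∑ U : OddSet n, levelWeight n t C w U M * (f U.1 *
        (∑ p : Fin n, c M p * ((if p ∈ U.1 then (1 : ℝ) else 0) * (if M.2.partner p ∈ U.1 then (1 : ℝ) else 0))) ^ 2) ≤ 1 * G * E := by
    intro c hc1 hcS
    rcases eq_or_lt_of_le hG0 with hG | hG
    · have hψ : ∀ U, f U = 0 := fun U => le_antisymm (by rw [hG]; exact hfG U) (hf0 U)
      simp [hψ, ← hG]
    · have hf1 : ∀ U : OddSet n, 0 ≤ f U.1 / G ∧ f U.1 / G ≤ 1 := fun U =>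
        ⟨div_nonneg (hf0 _) hG.le, (div_le_one hG).2 (hfG _)⟩
      have h166 := sum_posPart_containment_le_of_support (levelWeight n t C w) hR S (fun U => f U.1 / G) hf1 c hc1 hcS
      have hsum : ∑ M : PMatch n, ∑ U : OddSet n, levelWeight n t C w U M * (f U.1 *
          (∑ p : Fin n, c M p * ((if p ∈ U.1 then (1 : ℝ) else 0) * (if M.2.partner p ∈ U.1 then (1 : ℝ) else 0))) ^ 2) =
          G * ∑ M : PMatch n, ∑ U : OddSet n, levelWeight n t C w U M * (f U.1 / G *
          (∑ p : Fin n, c M p * ((if p ∈ U.1 then (1 : ℝ) else 0) * (if M.2.partner p ∈ U.1 then (1 : ℝ) else 0))) ^ 2) := by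
        rw [mul_sum]; refine sum_congr rfl fun M _ => ?_
        rw [mul_sum]; refine sum_congr rfl fun U _ => ?_
        field_simp
      rw [hsum, one_mul]
      refine mul_le_mul_of_nonneg_left ?_ hG.le
      exact le_trans (sum_le_sum fun M _ => le_max_left _ _) h166
  have h := amplitudeOne_of_supportedDirections hev hn256 hdes S f hG0 hf0 hfG hall β hβS hB Y hY
  have hEq : 1 * G * E = 20 * G * ((S.card : ℝ) ^ 2 * (2 * (n : ℝ)) ^ S.card) * Real.exp (-(a * (dq n : ℝ))) := by
    rw [hE]; ring
  rw [hEq] at h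
  exact h

end Summit.PneNP.PneNP.Theorems.ChebyshevTracialDesignSparseFactorAmplitudeOne
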